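import Summits.Ventures.LatticeQCDFlow.Scoring.NonabelianAreaLaw2DOpenWilsonLoop
import Summits.Ventures.LatticeQCDFlow.Scoring.UNOnePlaquetteTwoPoint
import Summits.Ventures.LatticeQCDFlow.Scoring.AdjointChannelPowers
import HarnessLib

/-!
# The exact second moment of two-dimensional `U(N)` Wilson loops: `⟨|tr W_{R×T}|²⟩_β = 1 + (N² − 1)·P_adj(β)^{RT}`

HONEST FRAMING: exact (Metropolis-corrected) sampling algorithms for lattice gauge theory;
figures of merit are autocorrelation/cost numbers at stated couplings and volumes; no
continuum-physics claim.

Venture `LatticeQCDFlow` (cell pub-lqcd), sub-topic `Scoring`; FANOUT row 5 (`s0-sun-a`), GEN-21.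
NEW WORK of the cell (placement rule).  The assembly announced in GEN-20's `AdjointChannelPowers`:
for the free-boundary `R × T` lattice of two-dimensional `U(N)` lattice Yang–Mills (`N ≥ 2`, every real
`β`, theory-2's conventions: weight `e^{−β(N − Re tr U_p)}` per plaquette, realised inside the torus
`(ℤ/L)²` with `R + 1 ≤ L`, `T + 1 ≤ L` as in GEN-18), the Wilson loop `W = W_{R×T}` along the boundary has

  **`⟨|tr W|²⟩_β = 1 + (N² − 1)·P_adj(β)^{RT}`**, `P_adj(β) = (⟨|tr U_p|²⟩_β − 1)/(N² − 1) = (M₂/D − 1)/(N² − 1)`,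

`D = det[I_{|i−j|}(β)]_{N×N} = ∫ e^{βRe tr u} du`, `M₂ = ∫ |tr u|² e^{βRe tr u} du` (the normalised ADJOINT
plaquette: `|tr u|² − 1` is the adjoint character, of dimension `N² − 1`).  With GEN-18's first moment
`⟨N⁻¹Re tr W⟩_β = P_N(β)^{RT}` this is the exact signal-to-noise law of Wilson-loop measurements in two
dimensions: the second moment decays to its Haar value `1` at the rate of the adjoint string tension while the
signal decays at twice the fundamental one.  Route (no characters, no Peter–Weyl):

* §1 `pow_apply_eq_channel_pow_single`, `trace_pow_eq_sum_channel_pow_single` — if a matrix on the index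
  pairs is the matrix of a linear channel `S` on `M_N(ℂ)` in the matrix units, `M_{(a,b),(c,d)} = S(E_{cd})_{ab}`,
  then `Mⁿ` is the matrix of `Sⁿ` and `tr Mⁿ = Σ_{ab} Sⁿ(E_{ab})_{ab}` (pure algebra; the channel as a linear map and
  its powers as iterates is GEN-21's §2 of `AdjointChannelPowers`);
* §2 `unitary_kroneckerConj_integral_eq_channel` — the one-plaquette Kronecker matrix
  `∫ (u ⊗ₖ ū)_{(a,b),(c,d)} e^{βRe tr u} du = ∫ (u E_{cd} u*)_{ab} e^{βRe tr u} du` IS the matrix of the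
  one-plaquette channel, which GEN-20's `UNOnePlaquetteTwoPoint` computed: `S(X) = A·X + B·tr(X)·1`,
  `A = (M₂ − D)/(N² − 1)`, `A + NB = D`; hence (`AdjointChannelPowers`) `tr Mⁿ = Dⁿ + (N² − 1)Aⁿ`
  (`unitary_trace_kroneckerConj_integral_pow`);
* §3 **`unitary_open_normSq_trace_wilsonLoop_eq`** — GEN-21's Kronecker form of the matrix area law
  (`NonabelianAreaLaw2DWilsonLoop` §5, representations `u ↦ u` and `u ↦ ū`) turns the loop into `tr M_β^{RT}`,
  `M_β = e^{−Nβ}M`; dividing by GEN-18's partition function `(e^{−Nβ}D)^{RT}`: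
  `∫ |tr W|² ∏_p e^{−β(N−Re tr U_p)} / ∫ ∏_p e^{−β(N−Re tr U_p)} = 1 + (N² − 1)·((M₂/D − 1)/(N² − 1))^{RT}`.

Published form: the `U(N)`/`SU(N)` heat-kernel and Wilson-action loop moments of 2-d Yang–Mills are
character sums (Gross–Taylor, Nucl. Phys. B400 (1993) 181; Drouffe–Zuber, Phys. Rept. 102 (1983) 1, §4);
here the Wilson action at finite `N` and `β`, elementary.  No `def`, nothing cited as a fact, 0 sorry.
-/

noncomputable section

open MeasureTheory Function Finset
open Literature.MathematicalPhysics.QuantumFieldTheory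
open Literature.MathematicalPhysics.QuantumLattice
open Summit.Ventures.LatticeQCDFlow.Theory2.Lattice
open Summit.Ventures.LatticeQCDFlow.Theory2.Lattice.TwoDim
open Literature.Analysis.FunctionSpaces (besselI)
open scoped Kronecker

namespace Summit.Ventures.LatticeQCDFlow.Scoring

/-! ## §1. The matrix of a linear channel in the matrix units: powers and traces -/

section ChannelMatrix

variable {N : ℕ}

/-- A matrix is the sum of its entries times the matrix units, indexed by pairs. -/
theorem matrix_eq_sum_prod_single (X : Matrix (Fin N) (Fin N) ℂ) :
    X = ∑ l : Fin N × Fin N, X l.1 l.2 • Matrix.single l.1 l.2 (1 : ℂ) := by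
  rw [Fintype.sum_prod_type]
  simp_rw [Matrix.smul_single, smul_eq_mul, mul_one]
  exact Matrix.matrix_eq_sum_single X

/-- **Powers of a channel matrix.**  If `M_{(a,b),(c,d)} = S(E_{cd})_{ab}` for a linear map `S` of
`M_N(ℂ)`, then `(Mⁿ)_{(a,b),(c,d)} = Sⁿ(E_{cd})_{ab}`. -/
theorem pow_apply_eq_channel_pow_single (S : Module.End ℂ (Matrix (Fin N) (Fin N) ℂ))
    (M : Matrix (Fin N × Fin N) (Fin N × Fin N) ℂ)
    (hM : ∀ k l : Fin N × Fin N, M k l = S (Matrix.single l.1 l.2 1) k.1 k.2) (n : ℕ)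
    (k l : Fin N × Fin N) : (M ^ n) k l = (S ^ n) (Matrix.single l.1 l.2 1) k.1 k.2 := by
  induction n generalizing k l with
  | zero =>
    rw [pow_zero, pow_zero, Module.End.one_apply, Matrix.one_apply, Matrix.single_apply]
    by_cases h : k = l
    · subst h; simp
    · rw [if_neg h, if_neg fun h' => h (Prod.ext h'.1.symm h'.2.symm)]
  | succ n ih =>
    rw [pow_succ, Matrix.mul_apply, pow_succ, Module.End.mul_apply]
    conv_rhs => rw [matrix_eq_sum_prod_single (S (Matrix.single l.1 l.2 1)), map_sum]
    rw [Matrix.sum_apply]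
    refine Finset.sum_congr rfl fun j _ => ?_
    rw [map_smul, Matrix.smul_apply, smul_eq_mul, ih k j, hM j l, mul_comm]

/-- **Traces of powers of a channel matrix**: `tr Mⁿ = Σ_{a,b} Sⁿ(E_{ab})_{ab}`. -/
theorem trace_pow_eq_sum_channel_pow_single (S : Module.End ℂ (Matrix (Fin N) (Fin N) ℂ))
    (M : Matrix (Fin N × Fin N) (Fin N × Fin N) ℂ)
    (hM : ∀ k l : Fin N × Fin N, M k l = S (Matrix.single l.1 l.2 1) k.1 k.2) (n : ℕ) :
    (M ^ n).trace = ∑ a : Fin N, ∑ b : Fin N, (S ^ n) (Matrix.single a b 1) a b := by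
  rw [Matrix.trace, Fintype.sum_prod_type]
  exact Finset.sum_congr rfl fun a _ => Finset.sum_congr rfl fun b _ =>
    pow_apply_eq_channel_pow_single S M hM n (a, b) (a, b)

end ChannelMatrix

/-! ## §2. The one-plaquette Kronecker matrix of `U(N)` is the matrix of the one-plaquette channel -/

section OnePlaquette

variable {N : ℕ}

/-- `(U E_{cd} U*)_{ab} = U_{ac} conj(U_{bd})`. -/
theorem conj_single_apply (U : Matrix (Fin N) (Fin N) ℂ) (a b c d : Fin N) :
    (U * Matrix.single c d (1 : ℂ) * star U) a b = U a c * star (U b d) := by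
  rw [Matrix.mul_apply, Finset.sum_eq_single_of_mem d (Finset.mem_univ d) (fun j _ hj => by
    rw [Matrix.mul_single_apply_of_ne (hbj := hj), zero_mul]),
    Matrix.mul_single_apply_same, mul_one, Matrix.star_apply]

/-- The Kronecker matrix `u ⊗ₖ ū` of a unitary, entrywise: `(u ⊗ₖ ū)_{(a,b),(c,d)} = (u E_{cd} u*)_{ab}`. -/
theorem kronecker_conj_apply (U : Matrix (Fin N) (Fin N) ℂ) (k l : Fin N × Fin N) :
    (U ⊗ₖ U.map (starRingEnd ℂ)) k l = (U * Matrix.single l.1 l.2 (1 : ℂ) * star U) k.1 k.2 := by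
  rw [Matrix.kroneckerMap_apply, Matrix.map_apply, conj_single_apply]
  rfl

/-- **The one-plaquette Kronecker matrix is the channel matrix** (`N ≥ 2`):
`∫ (u ⊗ₖ ū)_{(a,b),(c,d)} e^{βRe tr u} du = A·(E_{cd})_{ab} + B·tr(E_{cd})·δ_{ab} = S(E_{cd})_{ab}`,
`S(X) = A·X + B·tr(X)·1`, `A = (M₂ − D)/(N² − 1)`, `B = (D − A)/N` (GEN-20 `integral_unitary_conj_entry_mul_exp`). -/
theorem unitary_kroneckerConj_integral_eq_channel (hN : 2 ≤ N) (β : ℝ) (k l : Fin N × Fin N) :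
    ∫ u, (((u : Matrix.unitaryGroup (Fin N) ℂ) : Matrix (Fin N) (Fin N) ℂ) ⊗ₖ
        (((u : Matrix.unitaryGroup (Fin N) ℂ) : Matrix (Fin N) (Fin N) ℂ).map (starRingEnd ℂ))) k l *
        (Real.exp (β * ((u : Matrix.unitaryGroup (Fin N) ℂ) : Matrix (Fin N) (Fin N) ℂ).trace.re) : ℂ)
        ∂(haarProbability (Matrix.unitaryGroup (Fin N) ℂ)) =
      ((((∫ u, (‖((u : Matrix.unitaryGroup (Fin N) ℂ) : Matrix (Fin N) (Fin N) ℂ).trace‖ ^ 2 : ℝ) *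
          Real.exp (β * ((u : Matrix.unitaryGroup (Fin N) ℂ) : Matrix (Fin N) (Fin N) ℂ).trace.re)
          ∂(haarProbability (Matrix.unitaryGroup (Fin N) ℂ))) -
          (Matrix.of fun i j : Fin N => besselI ((i : ℤ) - (j : ℤ)).natAbs β).det) / ((N : ℝ) ^ 2 - 1) : ℝ) : ℂ) *
          Matrix.single l.1 l.2 (1 : ℂ) k.1 k.2 +
        ((((Matrix.of fun i j : Fin N => besselI ((i : ℤ) - (j : ℤ)).natAbs β).det -
          ((∫ u, (‖((u : Matrix.unitaryGroup (Fin N) ℂ) : Matrix (Fin N) (Fin N) ℂ).trace‖ ^ 2 : ℝ) *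
            Real.exp (β * ((u : Matrix.unitaryGroup (Fin N) ℂ) : Matrix (Fin N) (Fin N) ℂ).trace.re)
            ∂(haarProbability (Matrix.unitaryGroup (Fin N) ℂ))) -
            (Matrix.of fun i j : Fin N => besselI ((i : ℤ) - (j : ℤ)).natAbs β).det) / ((N : ℝ) ^ 2 - 1)) / N : ℝ) : ℂ) *
          ((Matrix.single l.1 l.2 (1 : ℂ)).trace * (1 : Matrix (Fin N) (Fin N) ℂ) k.1 k.2) := by
  simp_rw [kronecker_conj_apply]
  exact integral_unitary_conj_entry_mul_exp hN β (Matrix.single l.1 l.2 1) k.1 k.2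

/-- **`tr Mⁿ = Dⁿ + (N² − 1)·Aⁿ`** for the one-plaquette Kronecker matrix
`M_{(a,b),(c,d)} = ∫ (u ⊗ₖ ū)_{(a,b),(c,d)} e^{βRe tr u} du` of `U(N)`, `N ≥ 2`, where
`D = det[I_{|i−j|}(β)]`, `A = (M₂ − D)/(N² − 1)`, `M₂ = ∫ |tr u|² e^{βRe tr u} du`. -/
theorem unitary_trace_kroneckerConj_integral_pow (hN : 2 ≤ N) (β : ℝ) (n : ℕ) :
    ((Matrix.of fun k l : Fin N × Fin N => ∫ u, (((u : Matrix.unitaryGroup (Fin N) ℂ) : Matrix (Fin N) (Fin N) ℂ) ⊗ₖ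
        (((u : Matrix.unitaryGroup (Fin N) ℂ) : Matrix (Fin N) (Fin N) ℂ).map (starRingEnd ℂ))) k l *
        (Real.exp (β * ((u : Matrix.unitaryGroup (Fin N) ℂ) : Matrix (Fin N) (Fin N) ℂ).trace.re) : ℂ)
        ∂(haarProbability (Matrix.unitaryGroup (Fin N) ℂ))) ^ n).trace =
      (((Matrix.of fun i j : Fin N => besselI ((i : ℤ) - (j : ℤ)).natAbs β).det : ℝ) : ℂ) ^ n +
        ((N : ℂ) ^ 2 - 1) *
          ((((∫ u, (‖((u : Matrix.unitaryGroup (Fin N) ℂ) : Matrix (Fin N) (Fin N) ℂ).trace‖ ^ 2 : ℝ) *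
              Real.exp (β * ((u : Matrix.unitaryGroup (Fin N) ℂ) : Matrix (Fin N) (Fin N) ℂ).trace.re)
              ∂(haarProbability (Matrix.unitaryGroup (Fin N) ℂ))) -
              (Matrix.of fun i j : Fin N => besselI ((i : ℤ) - (j : ℤ)).natAbs β).det) / ((N : ℝ) ^ 2 - 1) : ℝ) : ℂ) ^ n := by
  haveI : NeZero N := ⟨by omega⟩
  set M₂ : ℝ := ∫ u, (‖((u : Matrix.unitaryGroup (Fin N) ℂ) : Matrix (Fin N) (Fin N) ℂ).trace‖ ^ 2 : ℝ) *
    Real.exp (β * ((u : Matrix.unitaryGroup (Fin N) ℂ) : Matrix (Fin N) (Fin N) ℂ).trace.re)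
    ∂(haarProbability (Matrix.unitaryGroup (Fin N) ℂ)) with hM₂
  set D : ℝ := (Matrix.of fun i j : Fin N => besselI ((i : ℤ) - (j : ℤ)).natAbs β).det with hD
  set A : ℂ := (((M₂ - D) / ((N : ℝ) ^ 2 - 1) : ℝ) : ℂ) with hA
  set B : ℂ := (((D - (M₂ - D) / ((N : ℝ) ^ 2 - 1)) / N : ℝ) : ℂ) with hB
  have hS : ∀ k l : Fin N × Fin N, (∫ u, (((u : Matrix.unitaryGroup (Fin N) ℂ) : Matrix (Fin N) (Fin N) ℂ) ⊗ₖ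
        (((u : Matrix.unitaryGroup (Fin N) ℂ) : Matrix (Fin N) (Fin N) ℂ).map (starRingEnd ℂ))) k l *
        (Real.exp (β * ((u : Matrix.unitaryGroup (Fin N) ℂ) : Matrix (Fin N) (Fin N) ℂ).trace.re) : ℂ)
        ∂(haarProbability (Matrix.unitaryGroup (Fin N) ℂ))) =
      ((A • LinearMap.id + B • (Matrix.traceLinearMap (Fin N) ℂ ℂ).smulRight (1 : Matrix (Fin N) (Fin N) ℂ) :
        Module.End ℂ (Matrix (Fin N) (Fin N) ℂ)) (Matrix.single l.1 l.2 1)) k.1 k.2 := by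
    intro k l
    rw [unitary_kroneckerConj_integral_eq_channel hN β k l, ← hM₂, ← hD]
    simp only [hA, hB, LinearMap.add_apply, LinearMap.smul_apply, LinearMap.id_apply, LinearMap.smulRight_apply,
      Matrix.traceLinearMap_apply, Matrix.add_apply, Matrix.smul_apply, smul_eq_mul]
  rw [trace_pow_eq_sum_channel_pow_single _ _ (fun k l => by rw [Matrix.of_apply]; exact hS k l) n]
  simp_rw [conjChannel_linearMap_pow_apply, sum_conjChannel_iterate_single]
  have hN0 : (N : ℂ) ≠ 0 := Nat.cast_ne_zero.2 (NeZero.ne N)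
  have hAB : A + N * B = (D : ℂ) := by
    rw [hA, hB]; push_cast; field_simp; ring
  rw [hAB]

end OnePlaquette

/-! ## §3. The second moment of the free-boundary `U(N)` Wilson loop -/

section WilsonLoop

variable {L : ℕ} [NeZero L] {N : ℕ}

/-- The conjugate defining representation `u ↦ ū` of `U(N)` is continuous. -/
theorem continuous_conj_unitaryFundamentalRep (N : ℕ) :
    Continuous (((starRingEnd ℂ).mapMatrix : Matrix (Fin N) (Fin N) ℂ →+* Matrix (Fin N) (Fin N) ℂ).toMonoidHom.comp
      (unitaryFundamentalRep (Fin N) ℂ)) :=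
  (continuous_unitaryFundamentalRep (Fin N) ℂ).matrix_map Complex.continuous_conj

/-- `tr ū = conj (tr u)`. -/
theorem trace_map_starRingEnd (U : Matrix (Fin N) (Fin N) ℂ) :
    (U.map (starRingEnd ℂ)).trace = starRingEnd ℂ U.trace := by
  simp only [Matrix.trace, Matrix.diag_apply, Matrix.map_apply, map_sum]

/-- **THE UNNORMALISED SECOND MOMENT**: `∫ |tr W_{R×T}|² ∏_p e^{−β(N − Re tr U_p)} dHaar^{⊗E} =
e^{−NβRT}·(D^{RT} + (N² − 1)·A^{RT})` (`N ≥ 2`, every real `β`; `R + 1 ≤ L`, `T + 1 ≤ L`). -/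
theorem unitary_open_normSq_trace_wilsonLoop_integral_eq (hN : 2 ≤ N) (β : ℝ) (i j : ZMod L) {R T : ℕ}
    (hR : R + 1 ≤ L) (hT : T + 1 ≤ L) :
    ∫ U, ((‖((rectangleHolonomy U ![i, j] 0 1 R T : Matrix.unitaryGroup (Fin N) ℂ) :
          Matrix (Fin N) (Fin N) ℂ).trace‖ ^ 2 : ℝ) : ℂ) *
        ∏ p ∈ (range R ×ˢ range T).image (fun q : ℕ × ℕ => (![i + q.1, j + q.2] : Site 2 L)),
          (Real.exp (-(β * ((N : ℝ) - ((plaquetteHolonomy U p 0 1 : Matrix.unitaryGroup (Fin N) ℂ) :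
            Matrix (Fin N) (Fin N) ℂ).trace.re))) : ℂ)
        ∂(Measure.pi fun _ : Edge 2 L => haarProbability (Matrix.unitaryGroup (Fin N) ℂ)) =
      (Real.exp (-(N * β)) : ℂ) ^ (R * T) *
        ((((Matrix.of fun i j : Fin N => besselI ((i : ℤ) - (j : ℤ)).natAbs β).det : ℝ) : ℂ) ^ (R * T) +
          ((N : ℂ) ^ 2 - 1) *
            ((((∫ u, (‖((u : Matrix.unitaryGroup (Fin N) ℂ) : Matrix (Fin N) (Fin N) ℂ).trace‖ ^ 2 : ℝ) *
                Real.exp (β * ((u : Matrix.unitaryGroup (Fin N) ℂ) : Matrix (Fin N) (Fin N) ℂ).trace.re)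
                ∂(haarProbability (Matrix.unitaryGroup (Fin N) ℂ))) -
                (Matrix.of fun i j : Fin N => besselI ((i : ℤ) - (j : ℤ)).natAbs β).det) / ((N : ℝ) ^ 2 - 1) : ℝ) : ℂ) ^
              (R * T)) := by
  have hw : Continuous fun u : Matrix.unitaryGroup (Fin N) ℂ =>
      Real.exp (-(β * ((N : ℝ) - ((u : Matrix.unitaryGroup (Fin N) ℂ) : Matrix (Fin N) (Fin N) ℂ).trace.re))) := by
    fun_prop
  have h := integral_trace_mul_trace_rectangleHolonomy_mul_prod_weight (unitaryFundamentalRep (Fin N) ℂ)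
    (((starRingEnd ℂ).mapMatrix : Matrix (Fin N) (Fin N) ℂ →+* Matrix (Fin N) (Fin N) ℂ).toMonoidHom.comp
      (unitaryFundamentalRep (Fin N) ℂ))
    (continuous_unitaryFundamentalRep (Fin N) ℂ) (continuous_conj_unitaryFundamentalRep N) hw
    (unitary_wilsonWeight_conj N β) i j hT hR
  have hlhs : ∀ U : GaugeConfig 2 L (Matrix.unitaryGroup (Fin N) ℂ),
      (unitaryFundamentalRep (Fin N) ℂ (rectangleHolonomy U ![i, j] 0 1 R T)).trace *
        ((((starRingEnd ℂ).mapMatrix : Matrix (Fin N) (Fin N) ℂ →+* Matrix (Fin N) (Fin N) ℂ).toMonoidHom.comp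
          (unitaryFundamentalRep (Fin N) ℂ)) (rectangleHolonomy U ![i, j] 0 1 R T)).trace =
        ((‖((rectangleHolonomy U ![i, j] 0 1 R T : Matrix.unitaryGroup (Fin N) ℂ) :
          Matrix (Fin N) (Fin N) ℂ).trace‖ ^ 2 : ℝ) : ℂ) := by
    intro U
    rw [MonoidHom.comp_apply, RingHom.toMonoidHom_eq_coe, MonoidHom.coe_coe, RingHom.mapMatrix_apply,
      unitaryFundamentalRep_apply, trace_map_starRingEnd, Complex.mul_conj, Complex.normSq_eq_norm_sq]
  simp_rw [hlhs] at h
  rw [h]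
  -- the weight splits off the constant `e^{−Nβ}`
  have hsplit : ∀ u : Matrix.unitaryGroup (Fin N) ℂ,
      (Real.exp (-(β * ((N : ℝ) - ((u : Matrix.unitaryGroup (Fin N) ℂ) : Matrix (Fin N) (Fin N) ℂ).trace.re))) : ℂ) =
        (Real.exp (-(N * β)) : ℂ) *
          (Real.exp (β * ((u : Matrix.unitaryGroup (Fin N) ℂ) : Matrix (Fin N) (Fin N) ℂ).trace.re) : ℂ) := by
    intro u; rw [← Complex.ofReal_mul, ← Real.exp_add]; congr 2; ring
  have hM : (Matrix.of fun k l : Fin N × Fin N => ∫ g, (unitaryFundamentalRep (Fin N) ℂ g ⊗ₖ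
      (((starRingEnd ℂ).mapMatrix : Matrix (Fin N) (Fin N) ℂ →+* Matrix (Fin N) (Fin N) ℂ).toMonoidHom.comp
        (unitaryFundamentalRep (Fin N) ℂ)) g) k l *
        (Real.exp (-(β * ((N : ℝ) - ((g : Matrix.unitaryGroup (Fin N) ℂ) : Matrix (Fin N) (Fin N) ℂ).trace.re))) : ℂ)
        ∂(haarProbability (Matrix.unitaryGroup (Fin N) ℂ))) =
      (Real.exp (-(N * β)) : ℂ) • (Matrix.of fun k l : Fin N × Fin N => ∫ u,
        (((u : Matrix.unitaryGroup (Fin N) ℂ) : Matrix (Fin N) (Fin N) ℂ) ⊗ₖ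
          (((u : Matrix.unitaryGroup (Fin N) ℂ) : Matrix (Fin N) (Fin N) ℂ).map (starRingEnd ℂ))) k l *
        (Real.exp (β * ((u : Matrix.unitaryGroup (Fin N) ℂ) : Matrix (Fin N) (Fin N) ℂ).trace.re) : ℂ)
        ∂(haarProbability (Matrix.unitaryGroup (Fin N) ℂ))) := by
    ext k l
    simp only [Matrix.of_apply, Matrix.smul_apply, smul_eq_mul, MonoidHom.comp_apply, RingHom.toMonoidHom_eq_coe,
      MonoidHom.coe_coe, RingHom.mapMatrix_apply, unitaryFundamentalRep_apply, hsplit]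
    rw [← integral_const_mul]
    exact integral_congr_ae (ae_of_all _ fun u => by ring)
  rw [hM, smul_pow, Matrix.trace_smul, smul_eq_mul, unitary_trace_kroneckerConj_integral_pow hN β (R * T)]

/-- **THE EXACT SECOND MOMENT OF TWO-DIMENSIONAL `U(N)` WILSON LOOPS WITH FREE BOUNDARY** (`N ≥ 2`, every
real `β`, every `R × T` loop with `R + 1 ≤ L`, `T + 1 ≤ L`):
`⟨|tr W_{R×T}|²⟩_β = ∫ |tr W|² ∏_p e^{−β(N−Re tr U_p)} / ∫ ∏_p e^{−β(N−Re tr U_p)} = 1 + (N² − 1)·P_adj(β)^{RT}`,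
`P_adj(β) = (M₂/D − 1)/(N² − 1)` the normalised adjoint plaquette (`M₂ = ∫ |tr u|² e^{βRe tr u} du`,
`D = det[I_{|i−j|}(β)]`).  At `β = 0` (`M₂ = D = 1`) the value is the Haar second moment `1`, and it tends to `1` as
`RT → ∞` whenever `|P_adj(β)| < 1`. -/
theorem unitary_open_normSq_trace_wilsonLoop_eq (hN : 2 ≤ N) (β : ℝ) (i j : ZMod L) {R T : ℕ}
    (hR : R + 1 ≤ L) (hT : T + 1 ≤ L) :
    (∫ U, ‖((rectangleHolonomy U ![i, j] 0 1 R T : Matrix.unitaryGroup (Fin N) ℂ) :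
          Matrix (Fin N) (Fin N) ℂ).trace‖ ^ 2 *
        ∏ p ∈ (range R ×ˢ range T).image (fun q : ℕ × ℕ => (![i + q.1, j + q.2] : Site 2 L)),
          Real.exp (-(β * ((N : ℝ) - ((plaquetteHolonomy U p 0 1 : Matrix.unitaryGroup (Fin N) ℂ) :
            Matrix (Fin N) (Fin N) ℂ).trace.re)))
        ∂(Measure.pi fun _ : Edge 2 L => haarProbability (Matrix.unitaryGroup (Fin N) ℂ))) /
      (∫ U, ∏ p ∈ (range R ×ˢ range T).image (fun q : ℕ × ℕ => (![i + q.1, j + q.2] : Site 2 L)),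
          Real.exp (-(β * ((N : ℝ) - ((plaquetteHolonomy U p 0 1 : Matrix.unitaryGroup (Fin N) ℂ) :
            Matrix (Fin N) (Fin N) ℂ).trace.re)))
        ∂(Measure.pi fun _ : Edge 2 L => haarProbability (Matrix.unitaryGroup (Fin N) ℂ))) =
      1 + ((N : ℝ) ^ 2 - 1) *
        (((∫ u, (‖((u : Matrix.unitaryGroup (Fin N) ℂ) : Matrix (Fin N) (Fin N) ℂ).trace‖ ^ 2 : ℝ) *
            Real.exp (β * ((u : Matrix.unitaryGroup (Fin N) ℂ) : Matrix (Fin N) (Fin N) ℂ).trace.re)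
            ∂(haarProbability (Matrix.unitaryGroup (Fin N) ℂ))) /
            (Matrix.of fun i j : Fin N => besselI ((i : ℤ) - (j : ℤ)).natAbs β).det - 1) / ((N : ℝ) ^ 2 - 1)) ^ (R * T) := by
  set M₂ : ℝ := ∫ u, (‖((u : Matrix.unitaryGroup (Fin N) ℂ) : Matrix (Fin N) (Fin N) ℂ).trace‖ ^ 2 : ℝ) *
    Real.exp (β * ((u : Matrix.unitaryGroup (Fin N) ℂ) : Matrix (Fin N) (Fin N) ℂ).trace.re)
    ∂(haarProbability (Matrix.unitaryGroup (Fin N) ℂ)) with hM₂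
  set D : ℝ := (Matrix.of fun i j : Fin N => besselI ((i : ℤ) - (j : ℤ)).natAbs β).det with hD
  have hDpos : 0 < D := det_besselI_toeplitz_fin_pos N β
  have hN1 : ((N : ℝ) ^ 2 - 1) ≠ 0 := by
    have h2 : (2 : ℝ) ≤ N := by exact_mod_cast hN
    nlinarith
  rw [unitary_open_partitionFunction_eq N β i j hR hT]
  have hnum := unitary_open_normSq_trace_wilsonLoop_integral_eq (L := L) hN β i j hR hT
  rw [← hM₂, ← hD] at hnum
  have hnum' : ∫ U, ‖((rectangleHolonomy U ![i, j] 0 1 R T : Matrix.unitaryGroup (Fin N) ℂ) :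
          Matrix (Fin N) (Fin N) ℂ).trace‖ ^ 2 *
        ∏ p ∈ (range R ×ˢ range T).image (fun q : ℕ × ℕ => (![i + q.1, j + q.2] : Site 2 L)),
          Real.exp (-(β * ((N : ℝ) - ((plaquetteHolonomy U p 0 1 : Matrix.unitaryGroup (Fin N) ℂ) :
            Matrix (Fin N) (Fin N) ℂ).trace.re)))
        ∂(Measure.pi fun _ : Edge 2 L => haarProbability (Matrix.unitaryGroup (Fin N) ℂ)) =
      Real.exp (-(N * β)) ^ (R * T) * (D ^ (R * T) + ((N : ℝ) ^ 2 - 1) * ((M₂ - D) / ((N : ℝ) ^ 2 - 1)) ^ (R * T)) := by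
    apply Complex.ofReal_injective
    rw [← integral_complex_ofReal]
    push_cast
    push_cast at hnum
    rw [← hnum]
  rw [hnum', mul_pow, mul_div_mul_left _ _ (pow_ne_zero _ (Real.exp_pos _).ne')]
  have hDn : D ^ (R * T) ≠ 0 := pow_ne_zero _ hDpos.ne'
  have hx : (M₂ - D) / ((N : ℝ) ^ 2 - 1) / D = (M₂ / D - 1) / ((N : ℝ) ^ 2 - 1) := by
    field_simp
  rw [add_div, div_self hDn, mul_div_assoc, ← div_pow, hx]


/-- **Sanity at `β = 0`** (pure Haar links, `N ≥ 2`, `RT ≥ 1`): `⟨|tr W_{R×T}|²⟩₀ = 1`, the Haar second moment of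
`|tr u|²` — the formula's `P_adj(0) = (M₂(0)/D(0) − 1)/(N² − 1) = 0` since `M₂(0) = D(0) = 1`. -/
theorem unitary_open_normSq_trace_wilsonLoop_eq_one (hN : 2 ≤ N) (i j : ZMod L) {R T : ℕ}
    (hR : R + 1 ≤ L) (hT : T + 1 ≤ L) (hRT : 0 < R * T) :
    (∫ U, ‖((rectangleHolonomy U ![i, j] 0 1 R T : Matrix.unitaryGroup (Fin N) ℂ) :
          Matrix (Fin N) (Fin N) ℂ).trace‖ ^ 2 *
        ∏ p ∈ (range R ×ˢ range T).image (fun q : ℕ × ℕ => (![i + q.1, j + q.2] : Site 2 L)),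
          Real.exp (-((0 : ℝ) * ((N : ℝ) - ((plaquetteHolonomy U p 0 1 : Matrix.unitaryGroup (Fin N) ℂ) :
            Matrix (Fin N) (Fin N) ℂ).trace.re)))
        ∂(Measure.pi fun _ : Edge 2 L => haarProbability (Matrix.unitaryGroup (Fin N) ℂ))) /
      (∫ U, ∏ p ∈ (range R ×ˢ range T).image (fun q : ℕ × ℕ => (![i + q.1, j + q.2] : Site 2 L)),
          Real.exp (-((0 : ℝ) * ((N : ℝ) - ((plaquetteHolonomy U p 0 1 : Matrix.unitaryGroup (Fin N) ℂ) :
            Matrix (Fin N) (Fin N) ℂ).trace.re)))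
        ∂(Measure.pi fun _ : Edge 2 L => haarProbability (Matrix.unitaryGroup (Fin N) ℂ))) = 1 := by
  rw [unitary_open_normSq_trace_wilsonLoop_eq (L := L) hN 0 i j hR hT, det_besselI_toeplitz_zero]
  have hM2 : (∫ u, (‖((u : Matrix.unitaryGroup (Fin N) ℂ) : Matrix (Fin N) (Fin N) ℂ).trace‖ ^ 2 : ℝ) *
      Real.exp (0 * ((u : Matrix.unitaryGroup (Fin N) ℂ) : Matrix (Fin N) (Fin N) ℂ).trace.re)
      ∂(haarProbability (Matrix.unitaryGroup (Fin N) ℂ))) = 1 := by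
    simp_rw [zero_mul, Real.exp_zero, mul_one, ← Complex.normSq_eq_norm_sq]
    exact Summit.Ventures.LatticeQCDFlow.TrivializingMaps.un_integral_normSq_trace (by omega)
  rw [hM2, div_one, sub_self, zero_div, zero_pow hRT.ne', mul_zero, add_zero]

end WilsonLoop

end Summit.Ventures.LatticeQCDFlow.Scoring
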